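import Mathlib.Analysis.SpecialFunctions.Complex.Arg
import Mathlib.Analysis.SpecialFunctions.Trigonometric.Angle
import Mathlib.MeasureTheory.Integral.IntervalIntegral.Basic
import Literature.Probability.RandomPlanarGeometry.LatticeFlowLineHarmonic
import Literature.Probability.RandomPlanarGeometry.LoewnerRegularCurves
import HarnessLib

/-!
# Passage vocabulary for lattice flow-line (imaginary-geometry) harmonic functionals

Definition file (route CriticalPhenomena/SAWScalingLimit/SAWTiltedExplorer; consumer: the repaired
crux `HarmonicWindingPassage`, stmt-CriticalPhenomena-8293, and the explorer items that feed it).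
Companion of `LatticeFlowLineHarmonic.lean` (the first-passage and backward-window bank rules) and
of `TiltedExplorer.lean`. It fixes, as REAL definitions with documented junk values, the
notions through which the passage of a lattice flow-line functional to the continuum is stated:

* `explorationFaces E ω` — the face sequence `f_0, f_1, …` of the hexagonal exploration path of the
  colouring `ω` (`explorationWalk`, `LatticeInterface.lean`), the process every explorer functional
  is read along;
* the **centred-window bank rule** (`centredWindowAngle`, `latticeFlowLineCentredData`,
  `latticeFlowLineHarmonicCentred`): the texture-free variant (c) of the bank data of
  `LatticeFlowLineHarmonic.lean` — a bank hexagon first passed by the dart `i₀` carries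
  `c (Â − π/2)/(π/3) ∓ g` with `Â` the direction of the displacement over the window of `2h + 1`
  darts CENTRED at `i₀`, unwrapped by anchoring on the dart angle `A_{i₀}` (no cumulative
  unwrapping), and the provisional adapted value `A_{i₀}` while the forward half-window is not yet
  explored (`i₀ + h ≥ n`). The one-sided (backward) window of variant (b) is biased on rough banks
  (harmonic-measure-weighted exposure–turning correlation; refuter evidence on stmt-8293), the
  centred one is not at second order;
* **prefix stopping rules and tests** (`IsPrefixStopping`, `IsPrefixDetermined`) — stopping times
  of the natural filtration of a face sequence and `𝓕_σ`-measurable test functionals, in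
  Galmarino's pathwise form — and the **tested near-martingale property**
  (`IsTestedNearMartingaleAt`) of a path functional under a mesh-indexed family of colouring laws:
  `|E[(X_{σ'} − X_σ) Ψ]| → 0` uniformly over bounded prefix stopping rules `σ ≤ σ'` that stop
  before the tip comes within `ρ` of a point `z`, and prefix tests `|Ψ| ≤ 1` (the hypothesis shape
  consumed by the Doob-martingale passage `Loewner.integral_cylinder_eq_zero_of_discreteMartingales`,
  `ObservableDiscretePassage.lean`);
* `IsKSRegularAlongMesh` — Kemppainen–Smirnov regularity of a mesh-indexed family of random curve
  classes in EVENT form through APPROXIMATING uniformizing maps `φ_δ → φ` (the hypotheses of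
  `ae_isLoewnerDescribable_and_tendstoInDistribution_of_regularCurves_varying`,
  `LoewnerRegularBoxes.lean`, indexed by the mesh filter `𝓝[>] 0` instead of a sequence);
* `IsBoundaryWindingDatum` — discrete imaginary-geometry boundary data `β` on the two arcs of a
  discretisation family, adapted to `(D, φ)` with a continuous branch `θ` of `arg φ' ∘ φ⁻¹`
  (the conclusion of the route's support item `BoundaryWindingData`, for a given `θ`), and
  `arcHarmonicExtension` (its discrete harmonic extension, the walk sum written there);
* `HasFarFieldFlowLineIdentities` — the far-field stopped cylinder identities of the κ = 8/3
  flow-line martingale observable `N^w_t = −(3/π)(arg Z_t − arg w) + (2/π)∫₀ᵗ Im(Z_s⁻²) ds`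
  (`= (𝔥_t − 𝔥_0)/λ'` for `imaginaryHarmonic (8/3) 0`, `ImaginaryGeometryHarmonic.lean`), the
  hypothesis of the route's identification item `WindingMartingaleIdentification` verbatim.

## What is proved

Unfolding lemmas; `|Â − A_{i₀}| ≤ π`; on the arcs the centred data are `β`; for hexagons first
passed within the last `h` darts the centred data ARE the first-passage data of
`LatticeFlowLineHarmonic.lean` (`latticeFlowLineCentredData_of_le`); boundedness of the data and of
the functional, harmonicity off the absorbing set (`isTriHarmonicExtension_…`), and the difference
from the first-passage functional as the absorbed extension of the (bounded by `3|c|`) window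
correction (`latticeFlowLineHarmonicCentred_sub`); constants and minima of prefix stopping rules.
No named fact is introduced.

## Junk values (documented)

`explorationFaces` is the constant face `((0,0),0)` when the exploration path is not (uniquely)
defined; the backward half-window is truncated at the start of the path (`ℕ`-subtraction `i − h`)
for hexagons passed by the first `h` darts; `firstPassage` junk is never read off the absorbing
set; `IsTestedNearMartingaleAt` integrates possibly non-integrable functions by Mathlib's junk `0`
(for admissible data every functional of the finitely many exploration paths is bounded and
measurable, `measurable_of_explorationWalk`).

## References

* O. Schramm, S. Sheffield, Ann. Probab. 33 (2005) = arXiv:math/0310210, §2 and §4 (Lemma 4,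
  Prop. 3: passage of the discrete harmonic martingale). [SchrammSheffield2005]
* J. Miller, S. Sheffield, *Imaginary geometry I*, arXiv:1201.1496, Thm. 1.1, Thm. 2.4.
  [MillerSheffield2016]
* A. Kemppainen, S. Smirnov, Ann. Probab. 45 (2017) = arXiv:1212.6215, Thm. 1.5, Cor. 1.7–1.8.
  [KemppainenSmirnov2017]
* D. Chelkak, H. Duminil-Copin, C. Hongler, A. Kemppainen, S. Smirnov, C. R. Math. 352 (2014), §3
  (approximating maps `φ^δ → φ`; martingale passage). [CDHKSCRAS2014]
* O. Kallenberg, *Foundations of Modern Probability* (2021), Lemma 9.3 / Thm. 7.12 (stopping times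
  of canonical filtrations; optional sampling). [folklore form used here]
-/

noncomputable section

open Finset MeasureTheory Filter
open scoped ENNReal NNReal

namespace Literature.Probability.RandomPlanarGeometry

open Literature.Probability.LatticeModels Literature.Probability.Percolation
open UpperHalfPlane (upperHalfPlaneSet)

/-! ### The face sequence of the exploration path -/

/-- **The face sequence of the hexagonal exploration path** of the colouring `ω` in the discrete
Dobrushin domain `E`: `i ↦` the `i`-th face of `explorationWalk E ω` (saturating at the final face),
and the junk constant face `((0,0),0)` when there is no (unique) exploration path — the case
excluded by admissibility (`existsUnique_explorationPath`). [cite: Smirnov2001, §2] -/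
def explorationFaces (E : DiscreteDobrushin) (ω : SiteConfig (Site 2)) : ℕ → HexVertex :=
  fun i =>
    match explorationWalk E ω with
    | some γ => γ.2.2.getVert i
    | none => (((0 : Site 2), (0 : Fin 2)) : HexVertex)

/-- Unfolding `explorationFaces` when the exploration path is defined. [folklore] -/
theorem explorationFaces_of_eq_some {E : DiscreteDobrushin} {ω : SiteConfig (Site 2)}
    {γ : Σ f g : HexVertex, hexGraph.Walk f g} (h : explorationWalk E ω = some γ) (i : ℕ) :
    explorationFaces E ω i = γ.2.2.getVert i := by
  simp [explorationFaces, h]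

/-- The junk value of `explorationFaces` when there is no exploration path. [folklore] -/
theorem explorationFaces_of_eq_none {E : DiscreteDobrushin} {ω : SiteConfig (Site 2)}
    (h : explorationWalk E ω = none) (i : ℕ) :
    explorationFaces E ω i = (((0 : Site 2), (0 : Fin 2)) : HexVertex) := by
  simp [explorationFaces, h]

/-- `explorationFaces` is a function of the exploration walk (hence measurable in `ω`,
`measurable_of_explorationWalk`). [folklore] -/
theorem explorationFaces_congr {E : DiscreteDobrushin} {ω ω' : SiteConfig (Site 2)}
    (h : explorationWalk E ω = explorationWalk E ω') : explorationFaces E ω = explorationFaces E ω' := by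
  funext i
  simp [explorationFaces, h]

/-! ### The centred-window bank rule -/

/-- **The centred-window direction anchored on the dart angle**: for the dart `i` of the face
sequence `P` and half-width `h`,
`Â_h(i) = A_i + pv (arg (c_{i+1+h} − c_{i−h}) − A_i)`, `A_i = dartAngle β P i` the unwrapped dart
angle (gauge anchored on `β`), `c_j = hexCenter (P j)`, `pv` the principal value in `(−π, π]`: the
direction of the displacement over the `2h + 1` darts `i − h, …, i + h` centred at `i`, in the
`2π`-sheet of the dart angle (no cumulative unwrapping). `ℕ`-subtraction truncates the window at the
start of the path for `i < h` (documented junk). [folklore] -/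
def centredWindowAngle (β : Site 2 → ℝ) (P : ℕ → HexVertex) (h i : ℕ) : ℝ :=
  dartAngle β P i +
    (((Complex.arg (hexCenter (P (i + 1 + h)) - hexCenter (P (i - h))) - dartAngle β P i : ℝ) :
      Real.Angle)).toReal

/-- The centred-window direction is within `π` of the dart angle. [folklore] -/
theorem abs_centredWindowAngle_sub_dartAngle_le (β : Site 2 → ℝ) (P : ℕ → HexVertex) (h i : ℕ) :
    |centredWindowAngle β P h i - dartAngle β P i| ≤ Real.pi := by
  rw [centredWindowAngle, add_sub_cancel_left]
  exact Real.Angle.abs_toReal_le_pi _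

open scoped Classical in
/-- **Centred-window bank data at time `n`** (variant (c), texture-free and ADAPTED): `β` on the two
discrete arcs; a bank hexagon `u` first passed by the dart `i₀ = firstPassage P u` carries
`c (Â − π/2)/(π/3) ∓ g` (`−` iff `u` is on the LEFT of that dart, `IsLeftOfDart`), where `Â` is the
centred-window direction `centredWindowAngle β P h i₀` once the forward half-window has been
explored (`i₀ + h < n`, i.e. the faces `P 0, …, P n` determine it) and the provisional value
`A_{i₀} = dartAngle β P i₀` before (so that the data at time `n` only read `P 0, …, P n`). The route
uses the continuum constants `c = 1/3`, `g = 1` (`(Â − π/2)/π ∓ 1`). [folklore] -/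
def latticeFlowLineCentredData (E : DiscreteDobrushin) (β : Site 2 → ℝ) (c g : ℝ) (h n : ℕ)
    (P : ℕ → HexVertex) : Site 2 → ℝ := fun u =>
  if u ∈ E.triArcA ∪ E.triArcB then β u
  else c * (((if firstPassage P u + h < n then centredWindowAngle β P h (firstPassage P u)
      else dartAngle β P (firstPassage P u)) - Real.pi / 2) / (Real.pi / 3)) +
    (if IsLeftOfDart P (firstPassage P u) u then -g else g)

/-- **The centred-window lattice flow-line harmonic functional** at time `n` (darts `i < n`
performed): the absorbed harmonic extension along `Ω_δ` (SRW on the hexagons, absorbed on the arcs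
and on the hexagons passed so far, `flowLineAbsorbing`) of the centred-window data, evaluated at the
hexagon `ζ`. [cite: SchrammSheffield2005, §2 (definition of HE)] -/
def latticeFlowLineHarmonicCentred (E : DiscreteDobrushin) (β : Site 2 → ℝ) (c g : ℝ) (h n : ℕ)
    (P : ℕ → HexVertex) (ζ : Site 2) : ℝ :=
  triHitExtension (triDiscreteDomainGraph E.Ω E.δ) (flowLineAbsorbing E P n)
    (latticeFlowLineCentredData E β c g h n P) ζ

section Centred

variable (E : DiscreteDobrushin) (β : Site 2 → ℝ) (c g : ℝ) (h : ℕ) (P : ℕ → HexVertex)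

/-- On the arcs the centred data are the boundary data `β`. [folklore] -/
theorem latticeFlowLineCentredData_of_mem_arcs (n : ℕ) {u : Site 2} (hu : u ∈ E.triArcA ∪ E.triArcB) :
    latticeFlowLineCentredData E β c g h n P u = β u := by
  unfold latticeFlowLineCentredData; rw [if_pos hu]

/-- **Provisional data = first-passage data**: a hexagon whose forward half-window is not yet
explored at time `n` (`n ≤ firstPassage P u + h`) carries the first-passage datum of
`LatticeFlowLineHarmonic.lean`. [folklore] -/
theorem latticeFlowLineCentredData_of_le {n : ℕ} {u : Site 2} (hn : n ≤ firstPassage P u + h) :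
    latticeFlowLineCentredData E β c g h n P u = latticeFlowLineData E β c g P u := by
  unfold latticeFlowLineCentredData latticeFlowLineData
  rw [if_neg (not_lt.2 hn)]

open scoped Classical in
/-- **The centred rule as a correction of the first-passage rule**: the data differ by
`c (Â − A_{i₀})/(π/3)` on the bank hexagons whose window is complete, and agree elsewhere.
[folklore] -/
theorem latticeFlowLineCentredData_sub (n : ℕ) (u : Site 2) :
    latticeFlowLineCentredData E β c g h n P u - latticeFlowLineData E β c g P u =
      if u ∈ E.triArcA ∪ E.triArcB then 0 else
        if firstPassage P u + h < n then
          c * ((centredWindowAngle β P h (firstPassage P u) - dartAngle β P (firstPassage P u)) /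
            (Real.pi / 3))
        else 0 := by
  unfold latticeFlowLineCentredData latticeFlowLineData
  split_ifs <;> ring

/-- The window correction is bounded by `3|c|` (`|Â − A| ≤ π`). [folklore] -/
theorem abs_latticeFlowLineCentredData_sub_le (n : ℕ) (u : Site 2) :
    |latticeFlowLineCentredData E β c g h n P u - latticeFlowLineData E β c g P u| ≤ 3 * |c| := by
  rw [latticeFlowLineCentredData_sub]
  have h3 : 0 ≤ 3 * |c| := by positivity
  split_ifs with h1 h2
  · rw [abs_zero]; exact h3
  · rw [abs_mul, mul_comm]
    refine mul_le_mul_of_nonneg_right ?_ (abs_nonneg c)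
    rw [abs_div, abs_of_pos (by positivity : (0 : ℝ) < Real.pi / 3), div_le_iff₀ (by positivity)]
    calc |centredWindowAngle β P h (firstPassage P u) - dartAngle β P (firstPassage P u)|
        ≤ Real.pi := abs_centredWindowAngle_sub_dartAngle_le β P h _
      _ = 3 * (Real.pi / 3) := by ring
  · rw [abs_zero]; exact h3

/-- The centred data are bounded on the absorbing set as soon as `β` is bounded on the arcs
(finitely many bank hexagons). [folklore] -/
theorem exists_abs_latticeFlowLineCentredData_le {B : ℝ} (hβ : ∀ u ∈ E.triArcA ∪ E.triArcB, |β u| ≤ B)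
    (n : ℕ) : ∃ M, 0 ≤ M ∧ ∀ u ∈ flowLineAbsorbing E P n, |latticeFlowLineCentredData E β c g h n P u| ≤ M :=
  exists_abs_le_on_union (passedHexagons_finite P n) fun u hu => by
    rw [latticeFlowLineCentredData_of_mem_arcs E β c g h P n hu]; exact hβ u hu

/-- **Boundary values**: on the absorbing set the functional is the datum. [folklore] -/
theorem latticeFlowLineHarmonicCentred_of_mem {n : ℕ} {ζ : Site 2} (hζ : ζ ∈ flowLineAbsorbing E P n) :
    latticeFlowLineHarmonicCentred E β c g h n P ζ = latticeFlowLineCentredData E β c g h n P ζ :=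
  triHitExtension_of_mem _ hζ

/-- On the arcs the functional is `β`. [folklore] -/
theorem latticeFlowLineHarmonicCentred_of_mem_arcs (n : ℕ) {ζ : Site 2} (hζ : ζ ∈ E.triArcA ∪ E.triArcB) :
    latticeFlowLineHarmonicCentred E β c g h n P ζ = β ζ := by
  rw [latticeFlowLineHarmonicCentred_of_mem E β c g h P (subset_flowLineAbsorbing E P n hζ),
    latticeFlowLineCentredData_of_mem_arcs E β c g h P n hζ]

/-- **The centred functional solves the Dirichlet problem** with the centred data on the absorbing
set (harmonic at the undetermined hexagons), for `β` bounded on the arcs. [cite: SchrammSheffield2005, §2 (definition of HE)] -/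
theorem isTriHarmonicExtension_latticeFlowLineHarmonicCentred {B : ℝ}
    (hβ : ∀ u ∈ E.triArcA ∪ E.triArcB, |β u| ≤ B) (n : ℕ) :
    IsTriHarmonicExtension (triDiscreteDomainGraph E.Ω E.δ) (flowLineAbsorbing E P n)ᶜ
      (latticeFlowLineCentredData E β c g h n P) (latticeFlowLineHarmonicCentred E β c g h n P) := by
  obtain ⟨M, -, hM⟩ := exists_abs_latticeFlowLineCentredData_le E β c g h P hβ n
  exact isTriHarmonicExtension_triHitExtension (triDiscreteDomainGraph_le_triGraph E.Ω E.δ) hM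

/-- **Boundedness by `max |data|`**. [folklore] -/
theorem abs_latticeFlowLineHarmonicCentred_le {n : ℕ} {M : ℝ} (hM0 : 0 ≤ M)
    (hM : ∀ u ∈ flowLineAbsorbing E P n, |latticeFlowLineCentredData E β c g h n P u| ≤ M) (ζ : Site 2) :
    |latticeFlowLineHarmonicCentred E β c g h n P ζ| ≤ M :=
  abs_triHitExtension_le (triDiscreteDomainGraph_le_triGraph E.Ω E.δ) hM0 hM ζ

open scoped Classical in
/-- **Centred minus first-passage functional = absorbed extension of the window correction** (zero
on the arcs and on the hexagons with an incomplete window). [folklore] -/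
theorem latticeFlowLineHarmonicCentred_sub {B : ℝ} (hβ : ∀ u ∈ E.triArcA ∪ E.triArcB, |β u| ≤ B)
    (n : ℕ) (ζ : Site 2) :
    latticeFlowLineHarmonicCentred E β c g h n P ζ - latticeFlowLineHarmonic E β c g n P ζ =
      triHitExtension (triDiscreteDomainGraph E.Ω E.δ) (flowLineAbsorbing E P n)
        (fun u => if u ∈ E.triArcA ∪ E.triArcB then 0 else
          if firstPassage P u + h < n then
            c * ((centredWindowAngle β P h (firstPassage P u) - dartAngle β P (firstPassage P u)) /
              (Real.pi / 3))
          else 0) ζ := by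
  obtain ⟨M₁, -, h₁⟩ := exists_abs_latticeFlowLineCentredData_le E β c g h P hβ n
  obtain ⟨M₂, -, h₂⟩ := exists_abs_latticeFlowLineData_le E β c g P hβ n
  unfold latticeFlowLineHarmonicCentred latticeFlowLineHarmonic
  rw [triHitExtension_sub (triDiscreteDomainGraph_le_triGraph E.Ω E.δ) h₁ h₂]
  refine congrArg (fun d => triHitExtension _ _ d ζ) (funext fun u => ?_)
  exact latticeFlowLineCentredData_sub E β c g h P n u

end Centred

/-! ### Prefix stopping rules, prefix tests, tested near-martingales -/

/-- `σ` is a **stopping rule of the natural filtration of a face sequence** (Galmarino's pathwise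
form of "`{σ = n}` is determined by the first `n + 1` faces"): if `P'` agrees with `P` up to time
`σ P` then `σ P' = σ P`. [folklore] -/
def IsPrefixStopping (σ : (ℕ → HexVertex) → ℕ) : Prop :=
  ∀ P P' : ℕ → HexVertex, (∀ i ≤ σ P, P' i = P i) → σ P' = σ P

/-- `Ψ` is **`𝓕_σ`-measurable** for the natural filtration of a face sequence (Galmarino's form):
`Ψ P' = Ψ P` whenever `P'` agrees with `P` up to time `σ P`. [folklore] -/
def IsPrefixDetermined (σ : (ℕ → HexVertex) → ℕ) (Ψ : (ℕ → HexVertex) → ℝ) : Prop :=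
  ∀ P P' : ℕ → HexVertex, (∀ i ≤ σ P, P' i = P i) → Ψ P' = Ψ P

/-- Constant times are stopping rules. [folklore] -/
theorem isPrefixStopping_const (n : ℕ) : IsPrefixStopping fun _ => n := fun _ _ _ => rfl

/-- The minimum of two stopping rules is a stopping rule. [folklore] -/
theorem isPrefixStopping_min {σ τ : (ℕ → HexVertex) → ℕ} (hσ : IsPrefixStopping σ)
    (hτ : IsPrefixStopping τ) : IsPrefixStopping fun P => min (σ P) (τ P) := by
  intro P P' hP
  dsimp only at hP ⊢
  rcases le_total (σ P) (τ P) with h | h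
  · rw [min_eq_left h] at hP
    have hσ' : σ P' = σ P := hσ P P' hP
    have hτ' : σ P ≤ τ P' := by
      by_contra hlt
      rw [not_le] at hlt
      have hag : ∀ i ≤ τ P', P i = P' i := fun i hi => (hP i (hi.trans hlt.le)).symm
      have h2 := hτ P' P hag
      omega
    rw [hσ', min_eq_left h, min_eq_left hτ']
  · rw [min_eq_right h] at hP
    have hτ' : τ P' = τ P := hτ P P' hP
    have hσ' : τ P ≤ σ P' := by
      by_contra hlt
      rw [not_le] at hlt
      have hag : ∀ i ≤ σ P', P i = P' i := fun i hi => (hP i (hi.trans hlt.le)).symm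
      have h2 := hσ P' P hag
      omega
    rw [hτ', min_eq_right h, min_eq_right hσ']

/-- A stopping rule is determined by the prefix it stops at (`σ` is `𝓕_σ`-measurable). [folklore] -/
theorem IsPrefixStopping.isPrefixDetermined_self {σ : (ℕ → HexVertex) → ℕ} (hσ : IsPrefixStopping σ) :
    IsPrefixDetermined σ fun P => (σ P : ℝ) := fun P P' h => by
  simp [hσ P P' h]

/-- **Tested near-martingale property at the point `z` before the approach distance `ρ`.** For a
mesh-indexed family of discrete Dobrushin data `E δ` and colouring laws `μ δ`, the path functional
`X δ n P` (time `n`, face sequence `P`) satisfies: for every `ε > 0`, for all sufficiently small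
meshes `δ > 0`, `|∫ (X δ (σ' P) P − X δ (σ P) P) Ψ(P) dμ_δ| ≤ ε` with `P = explorationFaces (E δ) ω`,
uniformly over the horizon `N`, the prefix stopping rules `σ ≤ σ' ≤ N` such that the tip face
`δ · hexCenter (P n)` stays at distance `> ρ` from `z` for all `n < σ' P`, and the `𝓕_σ`-measurable
prefix tests `|Ψ| ≤ 1`. Taking `Ψ = sign E[X_{σ'} − X_σ | 𝓕_σ]` this is
`E|E[X_{σ'} − X_σ | 𝓕_σ]| → 0`: the increments are conditionally centred on average over
mesoscopic stretches, which is weaker than a vanishing total absolute drift and is exactly what the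
Doob-martingale passage consumes (`B := X_{σ'} − E[X_{σ'} − X_σ | 𝓕_σ]`,
`Loewner.integral_cylinder_eq_zero_of_discreteMartingales`). [cite: CDHKSCRAS2014, §3 (martingale passage)] -/
def IsTestedNearMartingaleAt (E : ℝ → DiscreteDobrushin) (μ : ℝ → Measure (SiteConfig (Site 2)))
    (X : ℝ → ℕ → (ℕ → HexVertex) → ℝ) (z : ℂ) (ρ : ℝ) : Prop :=
  ∀ ε : ℝ, 0 < ε → ∀ᶠ δ : ℝ in nhdsWithin (0 : ℝ) (Set.Ioi 0),
    ∀ (N : ℕ) (σ σ' : (ℕ → HexVertex) → ℕ) (Ψ : (ℕ → HexVertex) → ℝ),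
      IsPrefixStopping σ → IsPrefixDetermined σ Ψ → IsPrefixStopping σ' →
      (∀ P, σ P ≤ σ' P ∧ σ' P ≤ N ∧ |Ψ P| ≤ 1) →
      (∀ P : ℕ → HexVertex, ∀ n < σ' P, ρ < dist ((δ : ℂ) * hexCenter (P n)) z) →
      |∫ ω, (X δ (σ' (explorationFaces (E δ) ω)) (explorationFaces (E δ) ω) -
          X δ (σ (explorationFaces (E δ) ω)) (explorationFaces (E δ) ω)) *
          Ψ (explorationFaces (E δ) ω) ∂(μ δ)| ≤ ε

/-- The tested near-martingale property is monotone in the approach distance: stopping earlier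
(larger `ρ`) is a special case. [folklore] -/
theorem IsTestedNearMartingaleAt.mono {E : ℝ → DiscreteDobrushin} {μ : ℝ → Measure (SiteConfig (Site 2))}
    {X : ℝ → ℕ → (ℕ → HexVertex) → ℝ} {z : ℂ} {ρ ρ' : ℝ} (h : IsTestedNearMartingaleAt E μ X z ρ)
    (hρ : ρ ≤ ρ') : IsTestedNearMartingaleAt E μ X z ρ' := by
  intro ε hε
  filter_upwards [h ε hε] with δ hδ N σ σ' Ψ hσ hΨ hσ' hle hfar
  exact hδ N σ σ' Ψ hσ hΨ hσ' hle fun P n hn => lt_of_le_of_lt hρ (hfar P n hn)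

/-! ### Kemppainen–Smirnov regularity along the mesh, in event form through approximating maps -/

/-- **KS-regular family along the mesh (event form, approximating uniformizers).** The random curve
classes `Y δ` under the laws `P δ` are Kemppainen–Smirnov regular towards the Dobrushin domain
`(D; a, b)` with chordal uniformizing map `φ`: there are Dobrushin domains `D_δ` with chordal
uniformizing maps `φ_δ` whose boundary extensions converge to that of `φ` uniformly on the compacts
`{0 ≤ im} ∩ B̄(0, R)` of the closed half-plane and uniformly at infinity, with `b_δ → b`, such that
for every `ε > 0` ONE regularity class `regularCurves (φ_δ) 𝔯` (`LoewnerRegularCurves.lean`: KS's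
event `E ∩ X_simple` — transience at `b`, capacity schedule, driving and tip moduli) carries
`P δ`-mass `≥ 1 − ε` of `Y δ` for all small `δ`. This is the mesh-indexed form of the hypotheses of
`ae_isLoewnerDescribable_and_tendstoInDistribution_of_regularCurves_varying` (KS Thm. 1.5 (ii)–(iii)
with Cor. 1.7–1.8 for approximating domains; CDHKS §3: "`φ^δ → φ`"), i.e. the OUTPUT of Condition
G2 via KS Prop. 3.2 / Thms. 3.9–3.10 (the probabilistic half, not in the tree); lattice interfaces do
not start at `a`, so the fixed-map classes `regularCurves φ 𝔯` are void for them and approximating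
maps are needed. [cite: KemppainenSmirnov2017, Thm. 1.5, Cor. 1.7–1.8 and §3.5] -/
def IsKSRegularAlongMesh (D : DobrushinDomain) (φ : ConformalEquiv upperHalfPlaneSet D.carrier)
    {Ωδ : ℝ → Type*} [∀ δ, MeasurableSpace (Ωδ δ)] (Y : ∀ δ, Ωδ δ → CurveClass ℂ)
    (P : ∀ δ, Measure (Ωδ δ)) : Prop :=
  ∃ (Dd : ℝ → DobrushinDomain) (φd : ∀ δ : ℝ, ConformalEquiv upperHalfPlaneSet (Dd δ).carrier),
    (∀ δ, (Dd δ).IsChordalUniformizing (φd δ)) ∧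
    (∀ R : ℝ, TendstoUniformlyOn (fun δ => (φd δ).boundaryExtension) φ.boundaryExtension
      (nhdsWithin (0 : ℝ) (Set.Ioi 0)) ({z : ℂ | 0 ≤ z.im} ∩ Metric.closedBall 0 R)) ∧
    (∀ ε : ℝ, 0 < ε → ∃ r : ℝ, ∀ᶠ δ : ℝ in nhdsWithin (0 : ℝ) (Set.Ioi 0), ∀ z : ℂ, 0 ≤ z.im →
      r ≤ ‖z‖ → dist ((φd δ).boundaryExtension z) ((Dd δ).pt 1) ≤ ε) ∧
    Tendsto (fun δ : ℝ => (Dd δ).pt 1) (nhdsWithin 0 (Set.Ioi 0)) (nhds (D.pt 1)) ∧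
    ∀ ε : ℝ≥0∞, 0 < ε → ∃ 𝔯 : LoewnerRegularity, ∀ᶠ δ : ℝ in nhdsWithin (0 : ℝ) (Set.Ioi 0),
      P δ ((Y δ) ⁻¹' (regularCurves (φd δ) 𝔯)ᶜ) ≤ ε

/-! ### Discrete imaginary-geometry boundary data adapted to `(D, φ, θ)` -/

open scoped Classical in
/-- **The discrete harmonic extension of the arc data `β`** inside the discrete domain of `E`
(SRW on `Ω_δ ⊆ δ𝕋` absorbed on the two discrete arcs), as the walk sum
`∑_u ∑_{p : ζ → u, first hit of the arcs at u} (1/6)^{|p|} β u` — literally the term `H0` of the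
route item `BoundaryWindingData`. [cite: SchrammSheffield2005, §2 (definition of HE)] -/
def arcHarmonicExtension (E : DiscreteDobrushin) (β : Site 2 → ℝ) (ζ : Site 2) : ℝ :=
  ∑' (u : Site 2), ∑' (p : (triDiscreteDomainGraph E.Ω E.δ).Walk ζ u),
    if u ∈ E.triArcA ∪ E.triArcB ∧ (∀ v ∈ p.support.dropLast, v ∉ E.triArcA ∪ E.triArcB) then
      (1 / 6 : ℝ) ^ p.length * β u else 0

/-- **Discrete κ = 8/3 imaginary-geometry boundary data with branch `θ`.** For a Dobrushin domain
`D` with chordal uniformizing map `φ`, a mesh-indexed discretisation family `E` and arc data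
`β δ`: `θ` is a continuous branch of `arg φ' ∘ φ⁻¹` on `D`; the discrete harmonic extensions of
`β δ` converge to `𝔥₀ = 3/2 − (3/π) arg φ⁻¹ + θ/π` (units `λ' = 1`: `λ = 3/2`, `χ = 1/π`;
Miller–Sheffield's flow-line boundary function transported by `φ`) uniformly on compacts (sup over
the lattice points of `K`); and the START GAUGE: `π (β(x_a) + β(y_b))/2 − θ(first examined hexagon)
→ 0` for the two hexagons of the first crossed edge — the conclusions (i), (ii) of the route item
`BoundaryWindingData` for the given `θ`. [cite: MillerSheffield2016, Thm. 1.1 and Fig. 1.10] -/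
def IsBoundaryWindingDatum (D : DobrushinDomain) (φ : ConformalEquiv upperHalfPlaneSet D.carrier)
    (E : ℝ → DiscreteDobrushin) (β : ℝ → Site 2 → ℝ) (θ : ℂ → ℝ) : Prop :=
  (ContinuousOn θ D.carrier ∧ ∀ z ∈ D.carrier,
    Complex.exp ((θ z : ℂ) * Complex.I) * (‖deriv (fun w : ℂ => φ w) (φ.symm z)‖ : ℂ) =
      deriv (fun w : ℂ => φ w) (φ.symm z)) ∧
  (∀ K : Set ℂ, IsCompact K → K ⊆ D.carrier →
    Tendsto (fun δ : ℝ => ⨆ ζ ∈ {ζ : Site 2 | triMeshPoint δ ζ ∈ K},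
      ENNReal.ofReal |arcHarmonicExtension (E δ) (β δ) ζ -
        (3 / 2 - 3 / Real.pi * Complex.arg (φ.symm (triMeshPoint δ ζ)) + θ (triMeshPoint δ ζ) / Real.pi)|)
      (nhdsWithin 0 (Set.Ioi 0)) (nhds 0)) ∧
  Tendsto (fun δ : ℝ => Real.pi *
      ((∑ u ∈ hexFaceVertices (explorationFaces (E δ) ∅ 0) ∩ hexFaceVertices (explorationFaces (E δ) ∅ 1),
        β δ u) / 2) -
      ∑ u ∈ hexFaceVertices (explorationFaces (E δ) ∅ 1) \ hexFaceVertices (explorationFaces (E δ) ∅ 0),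
        θ (triMeshPoint δ u))
    (nhdsWithin 0 (Set.Ioi 0)) (nhds 0)

/-! ### The far-field cylinder identities of the κ = 8/3 flow-line observable -/

/-- **Far-field stopped cylinder identities of the κ = 8/3 flow-line martingale observable** under
the law `ν` on curve classes, through the chordal uniformizing map `φ` of `(D; a, b)`. With
`W = drivingFunction φ c`, `Z_t = g_t(w) − W_t` (`Loewner.map`),
`N^w_t = −(3/π)(arg Z_t − arg w) + (2/π) ∫₀ᵗ Im(Z_s⁻²) ds` — the increment `(𝔥_t − 𝔥_0)(φ(w))/λ'`
of Miller–Sheffield's harmonic function for `κ = 8/3`, `ρ = 0` (`imaginaryHarmonic`,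
`ImaginaryGeometryHarmonic.lean`; Makarov–Smirnov's bosonic martingale observable) — and the
stopping time `τ^{w,m} = inf {t : m ≤ |W_t| ∨ |Z_t| ≤ 1/(m+1)} ∧ m`: for some `R` and every `w ∈ ℍ`
with `|w| > R`, all levels `m`, times `s ≤ t`, finitely many earlier times `S ≤ s` and continuous
cylinder tests `|ψ| ≤ 1`, the stopped increment `N_{t∧τ} − N_{s∧τ}` is integrable and orthogonal to
`ψ(W_S)`. This is verbatim the hypothesis of the route item `WindingMartingaleIdentification`
(martingale characterisation of chordal SLE_{8/3}). [cite: MillerSheffield2016, Thm. 2.4 (martingale characterisation)] -/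
def HasFarFieldFlowLineIdentities (D : DobrushinDomain) (φ : ConformalEquiv upperHalfPlaneSet D.carrier)
    (ν : Measure (CurveClass ℂ)) : Prop :=
  let Wd : CurveClass ℂ → ℝ≥0 → ℝ := fun c => drivingFunction φ c
  let Zf : ℂ → ℝ≥0 → CurveClass ℂ → ℂ := fun w t c => Loewner.map (Wd c) t w - (Wd c t : ℂ)
  let Nf : ℂ → ℝ≥0 → CurveClass ℂ → ℝ := fun w t c =>
    -(3 / Real.pi) * (Complex.arg (Zf w t c) - Complex.arg w) +
      (2 / Real.pi) * ∫ s in (0 : ℝ)..(t : ℝ), ((Zf w s.toNNReal c)⁻¹ ^ 2).im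
  let τf : ℂ → ℕ → CurveClass ℂ → ℝ≥0 := fun w m c =>
    sInf ({t : ℝ≥0 | (m : ℝ) ≤ |Wd c t| ∨ ‖Zf w t c‖ ≤ ((m : ℝ) + 1)⁻¹} ∪ {(m : ℝ≥0)})
  ∃ R : ℝ, ∀ w : ℂ, R < ‖w‖ → 0 < w.im →
    ∀ (m : ℕ) (s t : ℝ≥0), s ≤ t → ∀ (n : ℕ) (S : Fin n → ℝ≥0), (∀ k, S k ≤ s) →
      ∀ ψ : (Fin n → ℝ) → ℝ, Continuous ψ → (∀ v, |ψ v| ≤ 1) →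
        Integrable (fun c => (Nf w (min t (τf w m c)) c - Nf w (min s (τf w m c)) c) *
          ψ (fun k => Wd c (S k))) ν ∧
        ∫ c, (Nf w (min t (τf w m c)) c - Nf w (min s (τf w m c)) c) * ψ (fun k => Wd c (S k)) ∂ν = 0

end Literature.Probability.RandomPlanarGeometry

end
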